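import Literature.Topology.FourManifolds.TautFoliationsCollarImageSetup
import HarnessLib

/-!
# Plaque membership along the ring, and paths along the contour arcs

Topic: the coned fence collar, plan (d) F4 part A. For a square `Q` meeting the ring at a
generic radius `R`: (1) the filled disc map sends the contour arc `ringLevel Q R` into ONE plaque
of the box of `Q`, the plaque at the radial level (`fill_mem_plaque_of_mem_ringLevel`); (2) the
collar disc map `G` sends every point of `Q` at distance `R` from `c₀` (the ring arc in `Q`) into
the same plaque (`apply_mem_plaque_of_dist_eq`); (3) at a ring point of the boundary of `Q` the
two maps agree (`fill_eq_apply_of_mem_sphere`); (4) the contour arc is path connected, so any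
two of its points are joined by a path inside it (`exists_path_ringLevel`).

* `fill_mem_plaque_of_mem_ringLevel`, `apply_mem_plaque_of_dist_eq`,
  `fill_eq_apply_of_mem_sphere`, `isPathConnected_ringLevel`, `exists_path_ringLevel`
  (**proved**).

All statements are [folklore].
-/

noncomputable section

open Set Filter Metric Topology Function Real
open scoped unitInterval
open Literature.Topology.PlanarFoliations

namespace Literature.Topology.FourManifolds

namespace Foliation.ConePosition

open SquareGrid SquareGrid.Grid SquarePolar ConeSquare CollarRadius

variable {B : Type*} [NormedAddCommGroup B] [NormedSpace ℝ B] {M : Type*} [TopologicalSpace M] {F : Foliation B M}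
variable {Γ : C(I, F.GermSpace)} {τ₀ ε : ℝ} {Φ : I → ℝ → M} {c₀ : ℝ × ℝ} {L : ℝ} {hL : 0 < L} {G : ℝ × ℝ → M}
variable (P : ConePosition F G c₀ hL)

variable (hΦ : IsFenceOn F Γ τ₀ ε Φ univ) (hcl : ∀ τ ∈ Ioo (τ₀ - ε) (τ₀ + ε), Φ 1 τ = Φ 0 τ) {τ₁ : ℝ}
  (hτI : uIcc τ₀ τ₁ ⊆ Ioo (τ₀ - ε) (τ₀ + ε)) (h01 : τ₁ ≠ τ₀)
  (hG : ∀ x, L / 2 ≤ dist x c₀ → G x = Φ (angleParam c₀ x) (levelOfParam τ₀ τ₁ (1 - dist x c₀ / L)))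
  (hGc : Continuous G) (hn32 : 32 ≤ P.n)
  (hskelT : ∀ q k, P.gr.edge q k '' Icc 0 (2 * P.gr.ℓ) ⊆ {x | 7 * L / 8 ≤ dist x c₀} →
    ∀ s ∈ Icc 0 (2 * P.gr.ℓ), P.skel (P.gr.edge q k s) = G (P.gr.edge q k s))
  {R : ℝ} (hR : 15 * L / 16 ≤ R) {q : Fin P.n × Fin P.n} (hqR : (P.gr.sq q ∩ sphere c₀ R).Nonempty)

/-- **The filled map sends the contour arc into the plaque of the box at the radial level.**
[folklore] -/
theorem fill_mem_plaque_of_mem_ringLevel {x : ℝ × ℝ} (hx : x ∈ P.ringLevel q R) :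
    P.fill P.apex x ∈ plaque (P.box q) (P.radialHt q R) := by
  refine ⟨P.fill_mem_source P.apex_spec.1 hx.1, ?_⟩
  have h := P.height_fill_eq_coneHt hx.1
  exact h.trans hx.2

include hΦ hcl hτI hG hn32 hR hqR in
omit [NormedSpace ℝ B] in
/-- **The collar disc map sends the ring arc of the square into the same plaque.** [folklore] -/
theorem apply_mem_plaque_of_dist_eq {x : ℝ × ℝ} (hx : x ∈ P.gr.sq q) (hxR : dist x c₀ = R) :
    G x ∈ plaque (P.box q) (P.radialHt q R) := by
  refine ⟨F.subbox_subset_source (P.box_mem q) (P.apply_mem q q (P.gr.adj_refl q) x hx), ?_⟩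
  have h := P.height_eq_radialHt hΦ hcl hτI hG (P.sq_subset_collar hn32 hR hqR) hx
  rw [hxR] at h
  exact h

include hn32 hskelT hR hqR in
/-- **At a boundary point of a ring square the filled map is the disc map.** [folklore] -/
theorem fill_eq_apply_of_mem_sphere {x : ℝ × ℝ} (hx : x ∈ sphere (P.gr.centre q) P.gr.ℓ) : P.fill P.apex x = G x := by
  rw [P.fill_of_mem_sphere hx, P.skel_eq_of_mem_sphere_ring hn32 hskelT hR hqR hx]

include hΦ hcl hτI h01 hG hGc hn32 hskelT hR hqR in
omit [NormedSpace ℝ B] in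
/-- **The contour arc of a ring square is path connected.** [folklore] -/
theorem isPathConnected_ringLevel : IsPathConnected (P.ringLevel q R) := by
  have hrad := P.isRadial_of_ring hΦ hcl hτI h01 hG hGc hn32 hskelT hR hqR
  have hRm := P.radius_mem_range hqR
  have hℓR := P.ℓ_lt_radius hn32 hR
  have hne := P.ringLevel_nonempty hΦ hcl hτI h01 hG hGc hn32 hskelT hR hqR
  obtain ⟨hro, hfl⟩ := P.radialHt_lt_apex_or hΦ hcl hτI h01 hG hGc hn32 hskelT hR hqR
  by_cases hroof : P.roofPat q
  · exact hrad.isPathConnected_levelLine P.gr.hℓ hRm hℓR (P.apex_spec.2.1 q hroof) (hro hroof) (P.continuousOn_bdryHt q) hne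
  · exact hrad.isPathConnected_levelLine_floor P.gr.hℓ hRm hℓR (P.apex_spec.2.2 q hroof) (hfl hroof) (P.continuousOn_bdryHt q) hne

include hΦ hcl hτI h01 hG hGc hn32 hskelT hR hqR in
omit [NormedSpace ℝ B] in
/-- **Paths along the contour arc**: two points of the contour arc of a ring square are joined
by a path inside it. [folklore] -/
theorem exists_path_ringLevel {x y : ℝ × ℝ} (hx : x ∈ P.ringLevel q R) (hy : y ∈ P.ringLevel q R) :
    ∃ e : Path x y, ∀ t, e t ∈ P.ringLevel q R := by
  have hj := (P.isPathConnected_ringLevel hΦ hcl hτI h01 hG hGc hn32 hskelT hR hqR).joinedIn x hx y hy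
  exact ⟨hj.somePath, hj.somePath_mem⟩

end Foliation.ConePosition

end Literature.Topology.FourManifolds
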